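import Summits.QuantumFields.YangMills.Theorems.BalabanUVNodesN07SplitClauseHeadKnitRanged
import Summits.QuantumFields.YangMills.Theorems.BalabanUVNodesN07SplitClauseHeadAtMeetCube
import Summits.QuantumFields.YangMills.Theorems.BalabanUVNodesN07MeetFamilyAtRecord
import Literature.MathematicalPhysics.QuantumFieldTheory.Balaban1983to89.Node00.DomainsRefinement
import HarnessLib

/-!
# N07 [B11] (= [15] = [Balaban1985Variational]) Sect. F, road of record R0′, S6 HEAD — **THE OUTWARD MEET EDITION, FILE D: THE KNIT WITH `HCHART` KEYED ON PRINT's (150) FAMILY,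
# ANCHORED AND CLEAN** (n07-e `OUTWARD-MEET-EDITION-SPEC.md` (E4) = the «single point of change» of this lineage's FILE 7): the per-datum guarded token `DatumGaugeSplitTopStepCoreG` and
# the guarded [15] Prop. 8 step token CLOSED MODULO [6] Prop. 6, the ranged letters ∕ budget, and the chart lane's deliverable `HCHART-MEET` — now asked (i) ONLY at datums whose print box
# MEETS `Ω_{K−n}` within `3` (the meeting antecedent; n07-e LOCATED-HCHART-UNANCHORED-IDX, I.39995) and is CLEAN (MODULE 56), and (ii) at the family
# `HVd := domainsMeet (cubeDomains (F.P K) (cornerP Mc ρ idx) (sideP Mc ρ) ρ (K−n) hk) (domainsOfSeq s.Ω (K−n) hk)` — print's «Ω′_j = □_j (j < k), Ω′_k = □″_k = □_k ∩ Ω_k» —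
# whose kernel lies in the record's (`ker Q_{D″} ⊆ ker Q_{domainsOfSeq s.Ω}` levelwise, 44A), so that the chart lane's criticality input `h128` at `D″` is suppliable from the token's
# `hcrit` (n07-e §1: at an OUTWARD datum `ker Q_{cubeDomains} ⊄ T_{genSet}`); near `B`-rows on the cells of `□″_k^{(k)} ∪ □′_k^{(k−1)}` (k0-s1-w3's class), far rows uniform `β₂(ρ + M′)`

Cell `pub-ymgap`, width seat `pub-ymgap-dag-n07-w4` g5 (sub-target S6 = the HEAD; MODULE 57 default pen), CLAIM-1 path (3) ∕ INTENT-6 (cell bus).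
`--kind proof --supports stmt-QuantumFields-27364 --as helper` (K1⁹ per dag-lead KEY MAP v2); count-neutral; def-free.
[15] = [Balaban1985Variational]; [6] = [Balaban1985RegularSpaces]; [4] = [Balaban1984PropagatorsII]; [I] = [Balaban1987RG1].

THE GUARD (LOCATED, for plan g86∕g87 I.40244).  The meet's (2.1)-admissibility at the H-block `L·M_h` needs the RUN's grid numerics `hgran : L·M_h ∣ M·R_j` and
`hdiv : dCubeSide L M R_j j ∣ sitesPerDir 0` (`1 ≤ j ≤ k`; FILE D0) — statements about the token's ∀-bound run `(ν, M, g, K, k, s)`, so they can enter ONLY through the guard.  This file is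
therefore GUARD-GENERIC: `Adm : StepGuard F` with two displayed hypotheses — `Adm → c ≤ ν.M₁ ∧ k + c₀ ≤ F.m + K` (the V20-G conjuncts, read where FILE 7 read them) and `Adm → hgran ∧ hdiv`.
At the V20-G guard itself the second hypothesis is NOT derivable (`M` is a free letter of the run); at the plan's V21-G candidate `… ∧ F.L ^ c₁ ∣ M` it is `a′ + 1 ≤ c₁` (then
`L·M_h = L^{a′+1} ∣ L^{c₁} ∣ M ∣ M·R_j`) plus `hdiv`, which is a further run numeric (the torus side against the run's cube sides) — REPORTED, not decided here.  The (2.2) separation needs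
NO new letter: FILE D0 decouples the label block from the separation block, and `R·L·M_h + 1 ≤ ρ + 1 ≤ c ≤ ν.M₁ ≤ L·ν.M₁` is the V20-G floor.

WHAT IS PROVED (sorry-free; no definition; axioms standard).  ★★★ `datumGaugeSplitTopStepCoreG_of_prop6P_of_chartMeet F N` — FILE 7's knit with HCHART-MEET (anchored, clean, at `D″`,
near∕far rows in k0-s1-w3's shapes), the `t₂`∕`t₃` floors of HBUDGET in FILE C's currencies (`¼M′·max{4C_HB_Hβ₁, θ_Hβ₂}`, `2C_HB_Hs′`), guard-generic; ★★★
`prop8RegSepTopStepG_of_prop6P_of_chartMeet F N` — the guarded [15] Prop. 8 step token from it (k0-s1-w3 `prop8RegSepTopStepG_of_datumGaugeSplitCoreG`).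
PROOF ROUTE per datum: MODULE 56 level raising ⇒ meeting + clean premise; guard ⇒ V20-G conjuncts + grid numerics; n07-w3's box-keyed guarded S3 door; k0-s1-w3 `numerics_cornerP_of_levelGuard`;
record side — nesting (`s.chain`), block saturation (`blockSat_seqOfRecord`), collar «π(□) ⊆ Ω_{K−n−1}» (FILE D0 §4 ∘ 57a), `Adm22 D″ R (L·M_h)` (FILE D0 §3); HCHART-MEET; (153)'s `RE`-clauses
to every family kernel-finer than `D″` (44A `ker_QpE_le_of_domainsLe` ∘ `domainsMeet_le_left`); FILE C `localGaugeSplitOn_head159_meetCube_box`; `.of_le` to `Cδ_j + θε_j + Qε_j²`.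
HONEST SCOPE.  Count-neutral by-name composition; [6] Prop. 6 (`hP6`), HCHART-MEET, HLETTERS ∕ HBUDGET, the two guard hypotheses, `2L² ≤ B₃`, the smallness letters are HYPOTHESES —
displayed, NOT discharged, joint satisfiability at the record NOT claimed; NO stub registered or closed; nothing of [15]∕[6]∕[4] ANALYSIS asserted; K0⁷ ∕ K1⁹ NOT closed; N07 ∕ N05 NOT
discharged; counts unmoved (typed 28∕28 · discharged 5∕27); one finite 𝕋⁴ programme at fixed ε — the route closes the conditional finite-𝕋⁴ rung `BalabanLadder.UV` ONLY; the YM mass gap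
(Clay) is NOT proved by any of this; nothing continuum ∕ ℝ⁴ ∕ OS.  No `sorry`, no `def`, no `instance`, no `notation`.

RELATED IN THE TREE, NOT DUPLICATED: FILE 7 `…HeadKnitRanged` (the `cubeDomains`-keyed editions, unanchored — superseded for the chart lane by this file at outward datums, kept); FILE 5∕6;
FILE C ∕ D0 (CONSUMED); n07-e MODULE 56, n07-w3 `…DatumGauge152GuardedBox`, k0-s1-w3 `…K0HalvingStepOfCoreGuardedChain` (CONSUMED BY NAME).

References: [15] (144) p. 300, (147)–(153) p. 301, (157)–(159) pp. 302–303, (160)–(166) pp. 303–304, (168) p. 304, Prop. 8 p. 304; [6] Prop. 6 p. 99, (1.3)–(1.9) p. 77,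
(1.131) p. 99; [4] (2.1)–(2.4) p. 224, Cor. 2.8 p. 249; [I] (0.1) p. 251.
-/

set_option autoImplicit false

noncomputable section
open scoped BigOperators Matrix.Norms.L2Operator

namespace Summit.QuantumFields.YangMills.BalabanUVNodes.N07SplitClauseHeadKnitMeet

open Literature.MathematicalPhysics.QuantumFieldTheory.Balaban1983to89
open Literature.MathematicalPhysics.QuantumFieldTheory.Balaban1983to89.Node00
open Literature.MathematicalPhysics.QuantumFieldTheory.Balaban1983to89.B15DeterminingSets
open Literature.MathematicalPhysics.QuantumFieldTheory.Balaban1983to89.B12RegularSpaces111 (gaugeU expI grad)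
open B15Eq112TorusCover (cover)
open B14DomainGeom (Pt Within)
open B14.Eq213MaximalDomains (side cubeExt)
open B5Eq117TorusCarriers (Mk)
open B5Eq118OneStroke (iterBlockOf)
open B5Prop12FieldsLattice (distSite)
open B8Eq131Cubes (sqLo sqHi box cube)
open B8LeafModelZd (ZdIdx)
open B11Eq115Space (levOf)
open B6SectADomainsV1 (Domains)
open B6SectAOperatorsV1 (BondIdx RE dsE QpE)
open Literature.MathematicalPhysics.QuantumFieldTheory.BalabanImbrieJaffe1984to88.BIJ85AxialPropagator411 (BondSpace)
open T4Continuum (T4Family)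
open T4AxialGaugeSmallField (castSite)
open B16Sect1Backgrounds (toMS)
open GaugeField (gaugeAct)
open MatrixLog (mlog)
open Summit.QuantumFields.YangMills.Theorems.K0FlatCubeOpsTextP (flatH)
open Summit.QuantumFields.YangMills.BalabanUVNodes.N07HalvingStepTopOfLocalLetters (Letters10On)
open Summit.QuantumFields.YangMills.BalabanUVNodes.N07LocalLettersSplitCore (LocalGaugeSplitOn)
open Summit.QuantumFields.YangMills.BalabanUVNodes.N07LocalLettersCoreGuarded (DatumGaugeSplitTopStepCoreG)
open Summit.QuantumFields.YangMills.BalabanUVNodes.N07SplitClauseHeadAtMeetCube (localGaugeSplitOn_head159_meetCube_box)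
open Summit.QuantumFields.YangMills.BalabanUVNodes.N07MeetFamilyAtRecord (adm22_meetCube_trunc_seqOfRecord cover_mem_Ω_pred_of_meet_box)
open Summit.QuantumFields.YangMills.BalabanUVNodes.N07RecordDomainsAdm22 (blockSat_seqOfRecord)
open Summit.QuantumFields.YangMills.BalabanUVNodes.N07DatumGauge152Guarded (numerics_cornerP_of_levelGuard)
open Summit.QuantumFields.YangMills.BalabanUVNodes.N07DatumGauge152GuardedBox (datumGauge152_REfiner153_of_prop6P_guarded_box)
open Summit.QuantumFields.YangMills.BalabanUVNodes.N07SplitClauseLevelRaising (datumGaugeSplitTopStepCoreG_of_clean)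
open Summit.QuantumFields.YangMills.Theorems.K0HalvingStepOfCoreGuardedChain (prop8RegSepTopStepG_of_datumGaugeSplitCoreG)

open scoped Classical in
/-- ★★★ **THE KNIT WITH `HCHART` AT PRINT's (150) FAMILY, ANCHORED AND CLEAN** (statement in the header): the guarded per-datum token `DatumGaugeSplitTopStepCoreG F N suppDom Mc ρ Adm …`
for every guard `Adm` implying the V20-G conjuncts and the run's grid numerics, modulo [6] Prop. 6, the ranged HLETTERS ∕ HBUDGET, and HCHART-MEET.
[cite: Balaban1985Variational, (144) p.300, (147)–(153) p.301, (157)–(159) pp.302–303, (160)–(166) pp.303–304, (168) p.304, Prop. 8 p.304; Balaban1985RegularSpaces, Prop. 6 (1.135)–(1.138) p.99, (1.131) p.99; Balaban1984PropagatorsII, (2.1)–(2.4) p.224, Cor. 2.8 (2.150)–(2.151) p.249] -/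
theorem datumGaugeSplitTopStepCoreG_of_prop6P_of_chartMeet (F : T4Family) (N : ℕ) [NeZero N] :
    ∃ (Mh₀ R₀ : ℕ) (CS BS CH δH BH : ℝ), 0 ≤ CS ∧ 0 < BS ∧ 0 ≤ CH ∧ 0 < δH ∧ 0 < BH ∧
    ∀ {B₁ c₁ : ℝ} (_ : 0 ≤ B₁) (_ : 0 < c₁) {ρ : ℕ}
      (_ : letI : CStarAlgebra (MatA N) := {}; B8.Prop6Printed 4 (F.L : ℝ) B₁ c₁ (fun i : ZdIdx 4 F.L => zdCubP (MatA N) F.L ρ i))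
      -- structural letters: grid cube `Mc`, block height `a′` (`M_h = L^{a′} ≥ M_h⁰`), `R ≥ R₀`, the collar `ρ` with `L·M_h ∣ ρ`, `R·L·M_h ≤ ρ`, `L ≤ ρ`
      {Mc Mh R a' : ℕ} (_ : 1 ≤ Mc) (_ : Mc ≤ ρ) (_ : Mh = F.L ^ a') (_ : Mh₀ ≤ Mh) (_ : R₀ ≤ R) (_ : F.L * Mh ∣ ρ) (_ : R * (F.L * Mh) ≤ ρ) (hLρ : F.L ≤ ρ)
      -- the two constants of the plan's V20-G guard `c ≤ ν.M₁ ∧ k + c₀ ≤ F.m + K` and their side conditions, stated once (n07-w3 g7's two + the head's two)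
      {c c₀ : ℕ} (_ : (11 * 4 + 4 * ρ + Mc + 3) * F.L ≤ c) (_ : Mc + 11 * 4 + 6 * ρ ≤ 2 * F.L ^ c₀) (_ : F.m ≤ c₀) (_ : a' + 3 ≤ c₀)
      -- ★ THE GUARD: any step guard implying the V20-G conjuncts AND the run's grid numerics the meet's (2.1) needs (`hgran`: the H-block divides the run's cube letters; `hdiv`)
      (Adm : StepGuard F) (_ : ∀ (ν : Stage7Numerics) (M : ℕ) (g : ℕ → ℝ) (K k : ℕ) (s : SeqOfRecord F ν M g K k), Adm ν M g K k s → c ≤ ν.M₁ ∧ k + c₀ ≤ F.m + K)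
      (_ : ∀ (ν : Stage7Numerics) (M : ℕ) (g : ℕ → ℝ) (K k : ℕ) (s : SeqOfRecord F ν M g K k), Adm ν M g K k s → ∀ j : ℕ, 1 ≤ j → j ≤ k →
        F.L * Mh ∣ M * RkOfRecord (F.P K).L ν.r (g j) ∧ dCubeSide (F.P K).L M (RkOfRecord (F.P K).L ν.r (g j)) j ∣ (F.P K).sitesPerDir 0)
      -- the token's letters, `0 < B₃`, `a₀ ≤ a0OfP`, the (163)-type letter `θ_H` of the `H` doors
      {B₃ C θ Q a₀ a₁ θH : ℝ} (_ : 0 < B₃) (_ : 0 ≤ C) (_ : 0 ≤ θ) (_ : 0 ≤ Q) (_ : a₀ ≤ a0OfP F N Mc ρ B₁ c₁) (_ : 8 * CH * BH * Real.exp (-(δH * (ρ : ℝ))) ≤ θH)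
      -- the chart side's PER-LEVEL SIZE LETTERS, functions of the letters `(ε, δ)` and the level only
      (β₁ β₂ s' σ t₁ : (ℕ → ℝ) → (ℕ → ℝ) → ℕ → ℝ) (v av : (ℕ → ℝ) → (ℕ → ℝ) → ℕ → ℕ → ℝ)
      -- ★ HLETTERS (RANGED): signs and the row budget, asked only IN THE TOKEN's RANGE `0 < δ_j ≤ a₁`, `B₃δ_j ≤ ε_j ≤ a₀`
      (_ : ∀ (K : ℕ) (ε δ : ℕ → ℝ) (j : ℕ), 0 < δ j → δ j ≤ a₁ → B₃ * δ j ≤ ε j → ε j ≤ a₀ →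
        0 ≤ β₁ ε δ j ∧ 0 ≤ β₂ ε δ j ∧ 0 ≤ s' ε δ j ∧ σ ε δ j ≤ 1 / 2 ∧ (∀ i, 0 ≤ v ε δ j i) ∧ (∀ i, 0 ≤ av ε δ j i) ∧
        (∀ i ≤ j, (((F.P K).d * ((sideP (F.P K) Mc ρ + 4 * ρ + 3) * (F.P K).L ^ (j - i)) : ℕ) : ℝ) * (v ε δ j i + av ε δ j i) ≤ σ ε δ j))
      -- ★ HBUDGET (RANGED): thresholds above the doors' floors summing below the token's threshold, IN THE TOKEN's RANGE
      (_ : ∀ (K : ℕ) (ε δ : ℕ → ℝ) (j : ℕ), 0 < δ j → δ j ≤ a₁ → B₃ * δ j ≤ ε j → ε j ≤ a₀ → ∃ t₂ t₃ tD : ℝ,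
        1 / 4 * ((sideP (F.P K) Mc ρ : ℕ) : ℝ) * max (4 * CH * BH * β₁ ε δ j) (θH * β₂ ε δ j) < t₂ ∧
        2 * CH * BH * s' ε δ j < t₃ ∧ 2 * CS * BS * (4 * σ ε δ j) < tD ∧
        t₁ ε δ j + (t₂ + tD) + t₃ ≤ C * δ j + θ * ε j + Q * ε j ^ 2)
      -- ★ HCHART-MEET: the chart lane's per-datum deliverable at PRINT's (150) FAMILY `D″`, owed ONLY at datums whose print box MEETS `Ω_{K−n}` within 3 and is CLEAN
      (_ : ∀ (ν : Stage7Numerics) (M : ℕ) (g : ℕ → ℝ) (K k : ℕ) (s : SeqOfRecord F ν M g K k), Sect2.SeqSeparated ν.M₁ s → 0 < ν.M₁ →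
        Adm ν M g K k s → 1 ≤ k →
        ∀ (ε δ : ℕ → ℝ),
        (∀ n, n ≤ k → 0 < δ n ∧ δ n ≤ a₁) → (∀ n, n < k → δ n ≤ 2 * δ (n + 1)) → (∀ n, n < k → δ (n + 1) ≤ 2 * δ n) →
        (∀ n, n ≤ k → B₃ * δ n ≤ ε n ∧ ε n ≤ a₀) → (∀ n, n < k → ε n ≤ 2 * ε (n + 1)) → (∀ n, n < k → ε (n + 1) ≤ 2 * ε n) →
        ∀ W : MSField (F.P K) (SU N), Sect2.DataSmall7PTop (avOfRecord F N K) s.Ω (suppDomOfRecord F ν K s.Ω) k δ W →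
        ∀ U : GaugeField (F.P K) 0 (SU N),
        (∀ n, n ≤ k → PlaqSmallOn (Sect2.omegaPlaqsTop s.Ω (suppDomOfRecord F ν K s.Ω) n) (ε n * (F.P K).eta n ^ 2) U) →
        (∀ n, n ≤ k → Sect2.CoDivSmallOn (Sect2.omegaBondsTop s.Ω (suppDomOfRecord F ν K s.Ω) n) (ε n * (F.P K).eta n ^ 3) U) →
        AgreeOn (genSet s.Ω k) (avgFamily (avOfRecord F N K) U) W → IsCritOnFibre F N K (genSet s.Ω k) W U →
        ∀ (n : ℕ) (hk : K - n ≤ (F.P K).m + (F.P K).K), 1 ≤ K - n → K - n ≤ k → ∀ (idx : Pt (F.P K).d),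
        -- MEETING DATUMS ONLY (n07-e LOCATED-HCHART-UNANCHORED-IDX): the print box has a point within `3` of a lift of a site of `Ω_{K−n}`
        (∃ x ∈ box (F.P K).L (cornerP (F.P K) Mc ρ idx) (sideP (F.P K) Mc ρ) (K - n), ∃ y : Pt (F.P K).d, cover (F.P K) y ∈ s.Ω (K - n) ∧ Within ((3 : ℕ) : ℤ) x y) →
        -- CLEAN DATUMS ONLY (print p. 300 «□ intersecting Ω_j but not Ω_{j+1}»; n07-e LOCATED-INWARD-DATUM): top level, or the print box misses `Ω_{j+1}`
        (K - n = k ∨ ∀ z ∈ box (F.P K).L (cornerP (F.P K) Mc ρ idx) (sideP (F.P K) Mc ρ) (K - n), cover (F.P K) z ∉ s.Ω (K - n + 1)) →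
        -- THE FAMILY: print's (150) `Ω′_j = □_j (j < k), Ω′_k = □_k ∩ Ω_k` — the meet of the datum's cube tower with the record's regions (truncated at the datum's level)
        ∀ {HVd : Domains (F.P K)}
          (_ : HVd = domainsMeet (cubeDomains (F.P K) (cornerP (F.P K) Mc ρ idx) (sideP (F.P K) Mc ρ) ρ (K - n) hk) (domainsOfSeq s.Ω (K - n) hk))
          (lo hi : ℕ → Pt (F.P K).d),
        lo 0 = (fun i => ((F.P K).L : ℤ) * (sqLo (F.P K).L (cornerP (F.P K) Mc ρ idx) ρ (K - n) 1 i - 1)) →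
        hi 0 = (fun i => ((F.P K).L : ℤ) * (sqHi (F.P K).L (cornerP (F.P K) Mc ρ idx) (sideP (F.P K) Mc ρ) ρ (K - n) 1 i + 1) + (((F.P K).L : ℤ) - 1)) →
        (∀ j', 1 ≤ j' → lo j' = sqLo (F.P K).L (cornerP (F.P K) Mc ρ idx) ρ (K - n) j' - 1) →
        (∀ j', 1 ≤ j' → hi j' = sqHi (F.P K).L (cornerP (F.P K) Mc ρ idx) (sideP (F.P K) Mc ρ) ρ (K - n) j' + 1) →
        ∃ HV : (BondIdx HVd → MatA N) →ₗ[ℂ] (PBond (F.P K) 0 → MatA N),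
          (∀ (Bf : BondIdx HVd → MatA N) (b : PBond (F.P K) 0), HV Bf b = ∑ c, ((flatH (F.P K) (K - n) HVd (Pi.single c 1) b : ℝ) : ℂ) • Bf c) ∧
        ∀ (u : GaugeTransf (F.P K) 0 (SU N)) (A : PBond (F.P K) 0 → MatA N),
        (∀ b ∈ (Sect2.regionOfSet (F.P K) (cover (F.P K) '' box (F.P K).L (cornerP (F.P K) Mc ρ idx) (sideP (F.P K) Mc ρ) (K - n))).bonds,
          gaugeU (fun x => ιSU N (u x)) (fun b' => ιSU N (U b')) b = expI ((F.P K).eta (K - n)) (A b)) →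
        (∀ b ∈ (Sect2.regionOfSet (F.P K) (cover (F.P K) '' box (F.P K).L (cornerP (F.P K) Mc ρ idx) (sideP (F.P K) Mc ρ) (K - n))).bonds,
          ‖A b‖ < b9OfP F Mc ρ B₁ * ε (K - n)) →
        (∀ q ∈ (Sect2.regionOfSet (F.P K) (cover (F.P K) '' box (F.P K).L (cornerP (F.P K) Mc ρ idx) (sideP (F.P K) Mc ρ) (K - n))).dpairs,
          ‖grad ((F.P K).eta (K - n)) q.2.1 (fun y => A ⟨y, q.2.2⟩) q.1‖ < b9OfP F Mc ρ B₁ * ε (K - n)) →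
        (∀ b ∈ Sect2.bondsDeep (cover (F.P K) '' box (F.P K).L (cornerP (F.P K) Mc ρ idx) (sideP (F.P K) Mc ρ) (K - n)),
          ‖Sect2.codiffCurlA ((F.P K).eta (K - n)) A b.src b.dir‖ < b9OfP F Mc ρ B₁ * ε (K - n)) →
        (∀ b ∈ Sect2.bondsDeep (cover (F.P K) '' box (F.P K).L (cornerP (F.P K) Mc ρ idx) (sideP (F.P K) Mc ρ) (K - n)),
          ‖∑ ν' : Fin (F.P K).d, (((F.P K).eta (K - n) : ℝ) : ℂ)⁻¹ •
              (grad ((F.P K).eta (K - n)) ν' (fun y => A ⟨y, b.dir⟩) (b.src.unshift ν') - grad ((F.P K).eta (K - n)) ν' (fun y => A ⟨y, b.dir⟩) b.src)‖ <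
            b9OfP F Mc ρ B₁ * ε (K - n)) →
        (∀ D' : Domains (F.P K), LinearMap.ker (QpE D') ≤ LinearMap.ker (QpE HVd) → ∀ φ : MatA N →L[ℂ] ℂ,
          RE D' ((F.P K).eta (K - n))⁻¹ (dsE ((F.P K).eta (K - n))⁻¹ (WithLp.toLp 2 fun b => (φ (A b)).re : BondSpace (F.P K))) = 0 ∧
          RE D' ((F.P K).eta (K - n))⁻¹ (dsE ((F.P K).eta (K - n))⁻¹ (WithLp.toLp 2 fun b => (φ (A b)).im : BondSpace (F.P K))) = 0) →
        ∃ (xc : Pt (F.P K).d) (B B' : BondIdx HVd → MatA N) (A₁ : PBond (F.P K) 0 → MatA N)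
          (uL : GaugeTransf (F.P K) 0 (SU N)) (U₁ : GaugeField (F.P K) 0 (SU N)) (lam : (j : ℕ) → Site (F.P K) j → MatA N) (X : BondIdx HVd → MatA N),
          xc ∈ box (F.P K).L (cornerP (F.P K) Mc ρ idx) (sideP (F.P K) Mc ρ) (K - n) ∧
          -- near cells (print's `□″_k^{(k)} ∪ □′_k^{(k−1)}` + top cells: «level `K − n`, or source block in the next cube of the tower»): (160) CENTRED at `x_c`
          (∀ c : BondIdx HVd, ((c.1.1 : ℕ) = K - n ∨ blockOf c.1.2.src ∈ (cubeDomains (F.P K) (cornerP (F.P K) Mc ρ idx) (sideP (F.P K) Mc ρ) ρ (K - n) hk).Om ((c.1.1 : ℕ) + 1)) →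
            ‖B c‖ ≤ β₁ ε δ (K - n) * (distSite (Mk (F.P K) (c.1.1 : ℕ)) c.1.2.src (iterBlockOf (c.1.1 : ℕ) (cover (F.P K) xc)) + 1)) ∧
          -- far cells: (155) UNIFORM `β₂·(ρ + M′)`
          (∀ c : BondIdx HVd, ¬ ((c.1.1 : ℕ) = K - n ∨ blockOf c.1.2.src ∈ (cubeDomains (F.P K) (cornerP (F.P K) Mc ρ idx) (sideP (F.P K) Mc ρ) ρ (K - n) hk).Om ((c.1.1 : ℕ) + 1)) →
            ‖B c‖ ≤ β₂ ε δ (K - n) * ((ρ : ℝ) + ((sideP (F.P K) Mc ρ : ℕ) : ℝ))) ∧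
          (∀ c, ‖B' c‖ ≤ s' ε δ (K - n)) ∧
          (∀ j' ≤ K - n, ∀ c : PBond (F.P K) j', c.src ∈ (castSite '' Set.Icc (lo j') (hi j') : Set (Site (F.P K) j')) →
            c.tgt ∈ (castSite '' Set.Icc (lo j') (hi j') : Set (Site (F.P K) j')) →
              dist1 (Averaging.iter (avOfRecord F N K) j' (gaugeAct uL U₁) c) ≤ v ε δ (K - n) j') ∧
          (∀ j' ≤ K - n, ∀ c : PBond (F.P K) j', c.src ∈ (castSite '' Set.Icc (lo j') (hi j') : Set (Site (F.P K) j')) →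
            c.tgt ∈ (castSite '' Set.Icc (lo j') (hi j') : Set (Site (F.P K) j')) → dist1 (Averaging.iter (avOfRecord F N K) j' U₁ c) ≤ av ε δ (K - n) j') ∧
          (∀ (j' : ℕ) (y : Site (F.P K) j'), ‖lam j' y‖ ≤ ‖mlog (((((toMS uL j' (castSite (lo j')))⁻¹ * toMS uL j' y)⁻¹ : SU N)) : MatA N)‖) ∧
          (∀ c : BondIdx HVd, X c = LatticeFieldCalculus.grad (((F.P K).L : ℝ) ^ (K - n) / ((F.P K).L : ℝ) ^ (c.1.1 : ℕ)) (lam c.1.1) c.1.2) ∧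
          Letters10On (cover (F.P K) '' box (F.P K).L (cornerP (F.P K) Mc ρ idx) (sideP (F.P K) Mc ρ) (K - n)) ((F.P K).eta (K - n)) (t₁ ε δ (K - n)) A₁ ∧
          (∀ b, A b - HV X b = A₁ b + HV B b - HV B' b)),
      DatumGaugeSplitTopStepCoreG F N (fun ν K Ω => suppDomOfRecord F ν K Ω) Mc ρ Adm B₃ C θ Q (b9OfP F Mc ρ B₁) a₀ a₁ := by
  obtain ⟨Mh₀, R₀, CS, BS, CH, δH, BH, hCS, hBS, hCH, hδH, hBH, hmain⟩ := localGaugeSplitOn_head159_meetCube_box F N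
  refine ⟨Mh₀, R₀, CS, BS, CH, δH, BH, hCS, hBS, hCH, hδH, hBH, ?_⟩
  intro B₁ c₁ hB₁ hc₁ ρ hP6 Mc Mh R a' hMc hMcρ hMha hMh hR hdvd hRρ hLρ c c₀ hc hc₀ hmc₀ hac₀ Adm hAdm₁ hAdm₂ B₃ C θ Q a₀ a₁ θH hB₃ hC0 hθ0 hQ0 ha₀ h163
    β₁ β₂ s' σ t₁ v av hletters hbudget hchart
  -- the level-raising reduction (n07-e): the clause is owed at CLEAN datums whose print box MEETS `Ω_j`
  refine datumGaugeSplitTopStepCoreG_of_clean F N hMc hMcρ hB₃.le (b9OfP_pos (F := F) Mc ρ hB₁).le hC0 hθ0 hQ0 ?_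
  intro ν M g K k s hsep hM₁ hadm hk ε δ hδ hcompδ hcompδ' hε hεcomp hεcomp' W h7 U h17 h19 hfib hcrit j hj hjk a hmeet hclean
  -- the guard's two halves: the V20-G conjuncts and the run's grid numerics
  have hV20 : c ≤ ν.M₁ ∧ k + c₀ ≤ F.m + K := hAdm₁ ν M g K k s hadm
  have hgrid := hAdm₂ ν M g K k s hadm
  -- the level guard with `F.m ≤ c₀` puts every datum level below `K`: write it as `K − n`
  have hkK : k ≤ K := by have := hV20.2; omega
  obtain ⟨n, rfl⟩ : ∃ n, j = K - n := ⟨K - j, by omega⟩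
  have hk1 : 1 ≤ K - n := hj
  have hkP : K - n ≤ (F.P K).m + (F.P K).K := by
    have : (F.P K).m + (F.P K).K = F.m + K := rfl
    omega
  have hLρ' : (F.P K).L ≤ ρ := hLρ
  -- the letters' ranges at the datum's level
  have hr1 : 0 < δ (K - n) := (hδ _ hjk).1
  have hr2 : δ (K - n) ≤ a₁ := (hδ _ hjk).2
  have hr3 : B₃ * δ (K - n) ≤ ε (K - n) := (hε _ hjk).1
  have hr4 : ε (K - n) ≤ a₀ := (hε _ hjk).2
  have hε' : ∀ m, m ≤ k → 0 < ε m ∧ ε m ≤ a₀ := fun m hm => ⟨lt_of_lt_of_le (mul_pos hB₃ (hδ m hm).1) (hε m hm).1, (hε m hm).2⟩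
  obtain ⟨hβ₁, hβ₂, hs', hσ, hv0, ha0, hDσ⟩ := hletters K ε δ (K - n) hr1 hr2 hr3 hr4
  obtain ⟨t₂, t₃, tD, ht₂, ht₃, htD, hsum⟩ := hbudget K ε δ (K - n) hr1 hr2 hr3 hr4
  -- S3's gauge at this datum under the V20-G guard, BOX-keyed meeting (n07-w3 g7, by name), and the datum's numerics from the level guard
  obtain ⟨u, A, he, hA, hdA, hcd, hlap, h6⟩ := datumGauge152_REfiner153_of_prop6P_guarded_box (F := F) (N := N) hB₁ hc₁ hP6 hMc hc hc₀ ν g K k hLρ' s hsep hV20 ε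
    ha₀ hε' hεcomp U h17 h19 hk1 hjk a hmeet
  obtain ⟨ha, hM, hper, hinj⟩ := numerics_cornerP_of_levelGuard F hk1 hjk hV20.2 hMha (by omega) hLρ' hdvd hc₀ a
  have hρpos : 0 < ρ := lt_of_lt_of_le (F.P K).L_pos hLρ'
  have hM1 : 1 ≤ sideP (F.P K) Mc ρ := by have := le_sideP (P := F.P K) Mc hρpos; omega
  -- the canonical boxes of the datum's tower
  set lo : ℕ → Pt (F.P K).d := fun j' => if j' = 0 then (fun i => ((F.P K).L : ℤ) * (sqLo (F.P K).L (cornerP (F.P K) Mc ρ a) ρ (K - n) 1 i - 1))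
    else sqLo (F.P K).L (cornerP (F.P K) Mc ρ a) ρ (K - n) j' - 1 with hlo
  set hi : ℕ → Pt (F.P K).d := fun j' => if j' = 0 then
      (fun i => ((F.P K).L : ℤ) * (sqHi (F.P K).L (cornerP (F.P K) Mc ρ a) (sideP (F.P K) Mc ρ) ρ (K - n) 1 i + 1) + (((F.P K).L : ℤ) - 1))
    else sqHi (F.P K).L (cornerP (F.P K) Mc ρ a) (sideP (F.P K) Mc ρ) ρ (K - n) j' + 1 with hhi
  have hlo0 : lo 0 = fun i => ((F.P K).L : ℤ) * (sqLo (F.P K).L (cornerP (F.P K) Mc ρ a) ρ (K - n) 1 i - 1) := by simp [hlo]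
  have hhi0 : hi 0 = fun i => ((F.P K).L : ℤ) * (sqHi (F.P K).L (cornerP (F.P K) Mc ρ a) (sideP (F.P K) Mc ρ) ρ (K - n) 1 i + 1) + (((F.P K).L : ℤ) - 1) := by
    simp [hhi]
  have hloj : ∀ j', 1 ≤ j' → lo j' = sqLo (F.P K).L (cornerP (F.P K) Mc ρ a) ρ (K - n) j' - 1 := fun j' hj' => by
    simp [hlo, Nat.one_le_iff_ne_zero.mp hj']
  have hhij : ∀ j', 1 ≤ j' → hi j' = sqHi (F.P K).L (cornerP (F.P K) Mc ρ a) (sideP (F.P K) Mc ρ) ρ (K - n) j' + 1 := fun j' hj' => by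
    simp [hhi, Nat.one_le_iff_ne_zero.mp hj']
  -- THE RECORD SIDE OF THE MEET: nesting, block saturation (grid numerics), the window's collar «π(□) ⊆ Ω_{K−n−1}» (57a), and `Adm22 D″ R (L·M_h)` (FILE D0)
  have hnest : ∀ i : ℕ, 1 ≤ i → i < K - n → s.Ω (i + 1) ⊆ s.Ω i := fun i h1 hi => s.chain.Ω_succ_subset_Ω h1 (lt_of_lt_of_le hi hjk)
  have hdiv : ∀ j' : ℕ, 1 ≤ j' → j' ≤ K - n → dCubeSide (F.P K).L M (RkOfRecord (F.P K).L ν.r (g j')) j' ∣ (F.P K).sitesPerDir 0 :=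
    fun j' h1 hj' => (hgrid j' h1 (hj'.trans hjk)).2
  have hgran : ∀ j' : ℕ, 1 ≤ j' → j' ≤ K - n → F.L * Mh ∣ M * RkOfRecord (F.P K).L ν.r (g j') := fun j' h1 hj' => (hgrid j' h1 (hj'.trans hjk)).1
  have hsat : ∀ (j' : ℕ) (x x' : Site (F.P K) 0), 1 ≤ j' → j' ≤ K - n → iterBlockOf j' x = iterBlockOf j' x' → x ∈ s.Ω j' → x' ∈ s.Ω j' :=
    fun j' x x' h1 hj' => blockSat_seqOfRecord F ν M g K k (by have : (F.P K).m + (F.P K).K = F.m + K := rfl; omega) s (fun i h1 hi => (hgrid i h1 hi).2) j' x x' h1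
      (hj'.trans hjk)
  have hν1 : 1 ≤ ν.M₁ := hM₁
  have hfloor : 11 * (F.P K).d + 2 * ρ + Mc + 3 ≤ ν.M₁ := by
    have hd : (F.P K).d = 4 := rfl
    have hL1 : 1 ≤ F.L := by have := F.hL11; omega
    have : (11 * 4 + 4 * ρ + Mc + 3) ≤ (11 * 4 + 4 * ρ + Mc + 3) * F.L := Nat.le_mul_of_pos_right _ hL1
    rw [hd]; omega
  have hbox' : 2 ≤ K - n → ∀ z ∈ box (F.P K).L (cornerP (F.P K) Mc ρ a) (sideP (F.P K) Mc ρ) (K - n), cover (F.P K) z ∈ s.Ω (K - n - 1) :=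
    fun h2 => cover_mem_Ω_pred_of_meet_box F ν M g K k s hν1 hsep hfloor h2 hjk hmeet
  have hLMh : 1 ≤ F.L * Mh := by
    rw [hMha]
    exact Nat.one_le_iff_ne_zero.mpr (Nat.mul_ne_zero (by have := F.hL11; omega) (pow_ne_zero _ (by have := F.hL11; omega)))
  have hRsep : R * (F.L * Mh) + 1 ≤ (F.P K).L * ν.M₁ := by
    have hLP : (F.P K).L = F.L := rfl
    have hL1 : 1 ≤ F.L := by have := F.hL11; omega
    have h1 : ν.M₁ ≤ F.L * ν.M₁ := Nat.le_mul_of_pos_left _ hL1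
    have h2 : ρ + 1 ≤ c := by
      have : (11 * 4 + 4 * ρ + Mc + 3) ≤ (11 * 4 + 4 * ρ + Mc + 3) * F.L := Nat.le_mul_of_pos_right _ hL1
      omega
    rw [hLP]; omega
  have hAdmD := adm22_meetCube_trunc_seqOfRecord F ν M g K k s hjk hkP hLMh hν1 hRsep hsep hdiv hgran hdvd ha hM hper hRρ
  -- the chart side at this MEETING, CLEAN datum and gauge, at print's family
  obtain ⟨HV, hHV, hch⟩ := hchart ν M g K k s hsep hM₁ hadm hk ε δ hδ hcompδ hcompδ' hε hεcomp hεcomp' W h7 U h17 h19 hfib hcrit n hkP hk1 hjk a hmeet hclean rfl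
    lo hi hlo0 hhi0 hloj hhij
  -- (153)'s `RE`-clauses transfer to every family kernel-finer than the meet, hence than the cube tower (44A)
  have h6' : ∀ D' : Domains (F.P K), LinearMap.ker (QpE D') ≤
      LinearMap.ker (QpE (domainsMeet (cubeDomains (F.P K) (cornerP (F.P K) Mc ρ a) (sideP (F.P K) Mc ρ) ρ (K - n) hkP) (domainsOfSeq s.Ω (K - n) hkP))) →
      ∀ φ : MatA N →L[ℂ] ℂ,
        RE D' ((F.P K).eta (K - n))⁻¹ (dsE ((F.P K).eta (K - n))⁻¹ (WithLp.toLp 2 fun b => (φ (A b)).re : BondSpace (F.P K))) = 0 ∧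
        RE D' ((F.P K).eta (K - n))⁻¹ (dsE ((F.P K).eta (K - n))⁻¹ (WithLp.toLp 2 fun b => (φ (A b)).im : BondSpace (F.P K))) = 0 :=
    fun D' hD' φ => h6 hkP D' (hD'.trans (ker_QpE_le_of_domainsLe (domainsMeet_le_left _ _))) φ
  obtain ⟨xc, B, B', A₁, uL, U₁, lam, X, hxc, hX₁, hX₂, hB', hv, hav, hlam, hX, h₁, h159⟩ := hch u A he hA hdA hcd hlap h6'
  -- FILE C at this datum (print datum `a := cornerP`, `M′ := sideP`), then down to the token's threshold
  have hclause := hmain n K hk1 (by omega) hkP hMha hMh hR (by omega) hM1 hLρ hinj s.Ω hnest hsat hbox' hAdmD hHV hxc hβ₁ hβ₂ h163 hX₁ hX₂ hs' hB'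
    hlo0 hhi0 hloj hhij uL U₁ (v ε δ (K - n)) (av ε δ (K - n)) hv0 ha0 hσ hDσ hv hav lam hlam hX u he hA hdA h₁ h159 ht₂ ht₃ htD
  exact hclause.of_le le_rfl hsum

open scoped Classical in
/-- ★★★ **THE GUARDED [15] PROP. 8 STEP TOKEN FROM THE MEET KNIT** — §1 ∘ k0-s1-w3's `prop8RegSepTopStepG_of_datumGaugeSplitCoreG` (`2L² ≤ B₃`, `4C ≤ B₃`, `16θ ≤ 1`,
`(16Q + 1024κ²)a₀ ≤ 1`, `32κa₀ ≤ 1`, `κ := b9OfP F Mc ρ B₁`): `Prop8RegSepTopStepG F N suppDom Adm B₃ a₀ a₁` for EVERY guard `Adm` implying the V20-G conjuncts and the run's grid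
numerics, modulo [6] Prop. 6, HCHART-MEET, the ranged HLETTERS ∕ HBUDGET and the smallness letters (all displayed).  At the plan's V21-G candidate guard
`c ≤ ν.M₁ ∧ k + c₀ ≤ F.m + K ∧ F.L ^ c₁ ∣ M` (plan g86 I.40244) the two guard hypotheses are the arithmetic `a′ + 1 ≤ c₁` plus the run's `hdiv`; no stub registered or closed here.
[cite: Balaban1985Variational, Prop. 8 p.304, (150) p.301, (162)–(168) pp.303–304; Balaban1985RegularSpaces, Prop. 6 p.99, (1.3)–(1.9) p.77; Balaban1987RG1, (0.1) p.251] -/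
theorem prop8RegSepTopStepG_of_prop6P_of_chartMeet (F : T4Family) (N : ℕ) [NeZero N] :
    ∃ (Mh₀ R₀ : ℕ) (CS BS CH δH BH : ℝ), 0 ≤ CS ∧ 0 < BS ∧ 0 ≤ CH ∧ 0 < δH ∧ 0 < BH ∧
    ∀ {B₁ c₁ : ℝ} (_ : 0 ≤ B₁) (_ : 0 < c₁) {ρ : ℕ}
      (_ : letI : CStarAlgebra (MatA N) := {}; B8.Prop6Printed 4 (F.L : ℝ) B₁ c₁ (fun i : ZdIdx 4 F.L => zdCubP (MatA N) F.L ρ i))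
      -- structural letters: grid cube `Mc`, block height `a′` (`M_h = L^{a′} ≥ M_h⁰`), `R ≥ R₀`, the collar `ρ` with `L·M_h ∣ ρ`, `R·L·M_h ≤ ρ`, `L ≤ ρ`
      {Mc Mh R a' : ℕ} (_ : 1 ≤ Mc) (_ : Mc ≤ ρ) (_ : Mh = F.L ^ a') (_ : Mh₀ ≤ Mh) (_ : R₀ ≤ R) (_ : F.L * Mh ∣ ρ) (_ : R * (F.L * Mh) ≤ ρ) (hLρ : F.L ≤ ρ)
      -- the two constants of the plan's V20-G guard `c ≤ ν.M₁ ∧ k + c₀ ≤ F.m + K` and their side conditions, stated once (n07-w3 g7's two + the head's two)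
      {c c₀ : ℕ} (_ : (11 * 4 + 4 * ρ + Mc + 3) * F.L ≤ c) (_ : Mc + 11 * 4 + 6 * ρ ≤ 2 * F.L ^ c₀) (_ : F.m ≤ c₀) (_ : a' + 3 ≤ c₀)
      -- ★ THE GUARD: any step guard implying the V20-G conjuncts AND the run's grid numerics the meet's (2.1) needs (`hgran`: the H-block divides the run's cube letters; `hdiv`)
      (Adm : StepGuard F) (_ : ∀ (ν : Stage7Numerics) (M : ℕ) (g : ℕ → ℝ) (K k : ℕ) (s : SeqOfRecord F ν M g K k), Adm ν M g K k s → c ≤ ν.M₁ ∧ k + c₀ ≤ F.m + K)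
      (_ : ∀ (ν : Stage7Numerics) (M : ℕ) (g : ℕ → ℝ) (K k : ℕ) (s : SeqOfRecord F ν M g K k), Adm ν M g K k s → ∀ j : ℕ, 1 ≤ j → j ≤ k →
        F.L * Mh ∣ M * RkOfRecord (F.P K).L ν.r (g j) ∧ dCubeSide (F.P K).L M (RkOfRecord (F.P K).L ν.r (g j)) j ∣ (F.P K).sitesPerDir 0)
      -- the token's letters, `0 < B₃`, `a₀ ≤ a0OfP`, the (163)-type letter `θ_H` of the `H` doors
      {B₃ C θ Q a₀ a₁ θH : ℝ} (_ : 0 < B₃) (_ : 0 ≤ C) (_ : 0 ≤ θ) (_ : 0 ≤ Q) (_ : a₀ ≤ a0OfP F N Mc ρ B₁ c₁) (_ : 8 * CH * BH * Real.exp (-(δH * (ρ : ℝ))) ≤ θH)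
      -- V19's floor `2L² ≤ B₃` and the (162)–(166♭) smallness letters of the R0′ closers, `κ := b9OfP F Mc ρ B₁`
      (_ : 2 * (F.L : ℝ) ^ 2 ≤ B₃) (_ : 4 * C ≤ B₃) (_ : 16 * θ ≤ 1) (_ : (16 * Q + 1024 * b9OfP F Mc ρ B₁ ^ 2) * a₀ ≤ 1) (_ : 32 * b9OfP F Mc ρ B₁ * a₀ ≤ 1)
      -- the chart side's PER-LEVEL SIZE LETTERS, functions of the letters `(ε, δ)` and the level only
      (β₁ β₂ s' σ t₁ : (ℕ → ℝ) → (ℕ → ℝ) → ℕ → ℝ) (v av : (ℕ → ℝ) → (ℕ → ℝ) → ℕ → ℕ → ℝ)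
      -- ★ HLETTERS (RANGED): signs and the row budget, asked only IN THE TOKEN's RANGE `0 < δ_j ≤ a₁`, `B₃δ_j ≤ ε_j ≤ a₀`
      (_ : ∀ (K : ℕ) (ε δ : ℕ → ℝ) (j : ℕ), 0 < δ j → δ j ≤ a₁ → B₃ * δ j ≤ ε j → ε j ≤ a₀ →
        0 ≤ β₁ ε δ j ∧ 0 ≤ β₂ ε δ j ∧ 0 ≤ s' ε δ j ∧ σ ε δ j ≤ 1 / 2 ∧ (∀ i, 0 ≤ v ε δ j i) ∧ (∀ i, 0 ≤ av ε δ j i) ∧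
        (∀ i ≤ j, (((F.P K).d * ((sideP (F.P K) Mc ρ + 4 * ρ + 3) * (F.P K).L ^ (j - i)) : ℕ) : ℝ) * (v ε δ j i + av ε δ j i) ≤ σ ε δ j))
      -- ★ HBUDGET (RANGED): thresholds above the doors' floors summing below the token's threshold, IN THE TOKEN's RANGE
      (_ : ∀ (K : ℕ) (ε δ : ℕ → ℝ) (j : ℕ), 0 < δ j → δ j ≤ a₁ → B₃ * δ j ≤ ε j → ε j ≤ a₀ → ∃ t₂ t₃ tD : ℝ,
        1 / 4 * ((sideP (F.P K) Mc ρ : ℕ) : ℝ) * max (4 * CH * BH * β₁ ε δ j) (θH * β₂ ε δ j) < t₂ ∧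
        2 * CH * BH * s' ε δ j < t₃ ∧ 2 * CS * BS * (4 * σ ε δ j) < tD ∧
        t₁ ε δ j + (t₂ + tD) + t₃ ≤ C * δ j + θ * ε j + Q * ε j ^ 2)
      -- ★ HCHART-MEET: the chart lane's per-datum deliverable at PRINT's (150) FAMILY `D″`, owed ONLY at datums whose print box MEETS `Ω_{K−n}` within 3 and is CLEAN
      (_ : ∀ (ν : Stage7Numerics) (M : ℕ) (g : ℕ → ℝ) (K k : ℕ) (s : SeqOfRecord F ν M g K k), Sect2.SeqSeparated ν.M₁ s → 0 < ν.M₁ →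
        Adm ν M g K k s → 1 ≤ k →
        ∀ (ε δ : ℕ → ℝ),
        (∀ n, n ≤ k → 0 < δ n ∧ δ n ≤ a₁) → (∀ n, n < k → δ n ≤ 2 * δ (n + 1)) → (∀ n, n < k → δ (n + 1) ≤ 2 * δ n) →
        (∀ n, n ≤ k → B₃ * δ n ≤ ε n ∧ ε n ≤ a₀) → (∀ n, n < k → ε n ≤ 2 * ε (n + 1)) → (∀ n, n < k → ε (n + 1) ≤ 2 * ε n) →
        ∀ W : MSField (F.P K) (SU N), Sect2.DataSmall7PTop (avOfRecord F N K) s.Ω (suppDomOfRecord F ν K s.Ω) k δ W →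
        ∀ U : GaugeField (F.P K) 0 (SU N),
        (∀ n, n ≤ k → PlaqSmallOn (Sect2.omegaPlaqsTop s.Ω (suppDomOfRecord F ν K s.Ω) n) (ε n * (F.P K).eta n ^ 2) U) →
        (∀ n, n ≤ k → Sect2.CoDivSmallOn (Sect2.omegaBondsTop s.Ω (suppDomOfRecord F ν K s.Ω) n) (ε n * (F.P K).eta n ^ 3) U) →
        AgreeOn (genSet s.Ω k) (avgFamily (avOfRecord F N K) U) W → IsCritOnFibre F N K (genSet s.Ω k) W U →
        ∀ (n : ℕ) (hk : K - n ≤ (F.P K).m + (F.P K).K), 1 ≤ K - n → K - n ≤ k → ∀ (idx : Pt (F.P K).d),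
        -- MEETING DATUMS ONLY (n07-e LOCATED-HCHART-UNANCHORED-IDX): the print box has a point within `3` of a lift of a site of `Ω_{K−n}`
        (∃ x ∈ box (F.P K).L (cornerP (F.P K) Mc ρ idx) (sideP (F.P K) Mc ρ) (K - n), ∃ y : Pt (F.P K).d, cover (F.P K) y ∈ s.Ω (K - n) ∧ Within ((3 : ℕ) : ℤ) x y) →
        -- CLEAN DATUMS ONLY (print p. 300 «□ intersecting Ω_j but not Ω_{j+1}»; n07-e LOCATED-INWARD-DATUM): top level, or the print box misses `Ω_{j+1}`
        (K - n = k ∨ ∀ z ∈ box (F.P K).L (cornerP (F.P K) Mc ρ idx) (sideP (F.P K) Mc ρ) (K - n), cover (F.P K) z ∉ s.Ω (K - n + 1)) →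
        -- THE FAMILY: print's (150) `Ω′_j = □_j (j < k), Ω′_k = □_k ∩ Ω_k` — the meet of the datum's cube tower with the record's regions (truncated at the datum's level)
        ∀ {HVd : Domains (F.P K)}
          (_ : HVd = domainsMeet (cubeDomains (F.P K) (cornerP (F.P K) Mc ρ idx) (sideP (F.P K) Mc ρ) ρ (K - n) hk) (domainsOfSeq s.Ω (K - n) hk))
          (lo hi : ℕ → Pt (F.P K).d),
        lo 0 = (fun i => ((F.P K).L : ℤ) * (sqLo (F.P K).L (cornerP (F.P K) Mc ρ idx) ρ (K - n) 1 i - 1)) →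
        hi 0 = (fun i => ((F.P K).L : ℤ) * (sqHi (F.P K).L (cornerP (F.P K) Mc ρ idx) (sideP (F.P K) Mc ρ) ρ (K - n) 1 i + 1) + (((F.P K).L : ℤ) - 1)) →
        (∀ j', 1 ≤ j' → lo j' = sqLo (F.P K).L (cornerP (F.P K) Mc ρ idx) ρ (K - n) j' - 1) →
        (∀ j', 1 ≤ j' → hi j' = sqHi (F.P K).L (cornerP (F.P K) Mc ρ idx) (sideP (F.P K) Mc ρ) ρ (K - n) j' + 1) →
        ∃ HV : (BondIdx HVd → MatA N) →ₗ[ℂ] (PBond (F.P K) 0 → MatA N),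
          (∀ (Bf : BondIdx HVd → MatA N) (b : PBond (F.P K) 0), HV Bf b = ∑ c, ((flatH (F.P K) (K - n) HVd (Pi.single c 1) b : ℝ) : ℂ) • Bf c) ∧
        ∀ (u : GaugeTransf (F.P K) 0 (SU N)) (A : PBond (F.P K) 0 → MatA N),
        (∀ b ∈ (Sect2.regionOfSet (F.P K) (cover (F.P K) '' box (F.P K).L (cornerP (F.P K) Mc ρ idx) (sideP (F.P K) Mc ρ) (K - n))).bonds,
          gaugeU (fun x => ιSU N (u x)) (fun b' => ιSU N (U b')) b = expI ((F.P K).eta (K - n)) (A b)) →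
        (∀ b ∈ (Sect2.regionOfSet (F.P K) (cover (F.P K) '' box (F.P K).L (cornerP (F.P K) Mc ρ idx) (sideP (F.P K) Mc ρ) (K - n))).bonds,
          ‖A b‖ < b9OfP F Mc ρ B₁ * ε (K - n)) →
        (∀ q ∈ (Sect2.regionOfSet (F.P K) (cover (F.P K) '' box (F.P K).L (cornerP (F.P K) Mc ρ idx) (sideP (F.P K) Mc ρ) (K - n))).dpairs,
          ‖grad ((F.P K).eta (K - n)) q.2.1 (fun y => A ⟨y, q.2.2⟩) q.1‖ < b9OfP F Mc ρ B₁ * ε (K - n)) →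
        (∀ b ∈ Sect2.bondsDeep (cover (F.P K) '' box (F.P K).L (cornerP (F.P K) Mc ρ idx) (sideP (F.P K) Mc ρ) (K - n)),
          ‖Sect2.codiffCurlA ((F.P K).eta (K - n)) A b.src b.dir‖ < b9OfP F Mc ρ B₁ * ε (K - n)) →
        (∀ b ∈ Sect2.bondsDeep (cover (F.P K) '' box (F.P K).L (cornerP (F.P K) Mc ρ idx) (sideP (F.P K) Mc ρ) (K - n)),
          ‖∑ ν' : Fin (F.P K).d, (((F.P K).eta (K - n) : ℝ) : ℂ)⁻¹ •
              (grad ((F.P K).eta (K - n)) ν' (fun y => A ⟨y, b.dir⟩) (b.src.unshift ν') - grad ((F.P K).eta (K - n)) ν' (fun y => A ⟨y, b.dir⟩) b.src)‖ <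
            b9OfP F Mc ρ B₁ * ε (K - n)) →
        (∀ D' : Domains (F.P K), LinearMap.ker (QpE D') ≤ LinearMap.ker (QpE HVd) → ∀ φ : MatA N →L[ℂ] ℂ,
          RE D' ((F.P K).eta (K - n))⁻¹ (dsE ((F.P K).eta (K - n))⁻¹ (WithLp.toLp 2 fun b => (φ (A b)).re : BondSpace (F.P K))) = 0 ∧
          RE D' ((F.P K).eta (K - n))⁻¹ (dsE ((F.P K).eta (K - n))⁻¹ (WithLp.toLp 2 fun b => (φ (A b)).im : BondSpace (F.P K))) = 0) →
        ∃ (xc : Pt (F.P K).d) (B B' : BondIdx HVd → MatA N) (A₁ : PBond (F.P K) 0 → MatA N)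
          (uL : GaugeTransf (F.P K) 0 (SU N)) (U₁ : GaugeField (F.P K) 0 (SU N)) (lam : (j : ℕ) → Site (F.P K) j → MatA N) (X : BondIdx HVd → MatA N),
          xc ∈ box (F.P K).L (cornerP (F.P K) Mc ρ idx) (sideP (F.P K) Mc ρ) (K - n) ∧
          -- near cells (print's `□″_k^{(k)} ∪ □′_k^{(k−1)}` + top cells: «level `K − n`, or source block in the next cube of the tower»): (160) CENTRED at `x_c`
          (∀ c : BondIdx HVd, ((c.1.1 : ℕ) = K - n ∨ blockOf c.1.2.src ∈ (cubeDomains (F.P K) (cornerP (F.P K) Mc ρ idx) (sideP (F.P K) Mc ρ) ρ (K - n) hk).Om ((c.1.1 : ℕ) + 1)) →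
            ‖B c‖ ≤ β₁ ε δ (K - n) * (distSite (Mk (F.P K) (c.1.1 : ℕ)) c.1.2.src (iterBlockOf (c.1.1 : ℕ) (cover (F.P K) xc)) + 1)) ∧
          -- far cells: (155) UNIFORM `β₂·(ρ + M′)`
          (∀ c : BondIdx HVd, ¬ ((c.1.1 : ℕ) = K - n ∨ blockOf c.1.2.src ∈ (cubeDomains (F.P K) (cornerP (F.P K) Mc ρ idx) (sideP (F.P K) Mc ρ) ρ (K - n) hk).Om ((c.1.1 : ℕ) + 1)) →
            ‖B c‖ ≤ β₂ ε δ (K - n) * ((ρ : ℝ) + ((sideP (F.P K) Mc ρ : ℕ) : ℝ))) ∧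
          (∀ c, ‖B' c‖ ≤ s' ε δ (K - n)) ∧
          (∀ j' ≤ K - n, ∀ c : PBond (F.P K) j', c.src ∈ (castSite '' Set.Icc (lo j') (hi j') : Set (Site (F.P K) j')) →
            c.tgt ∈ (castSite '' Set.Icc (lo j') (hi j') : Set (Site (F.P K) j')) →
              dist1 (Averaging.iter (avOfRecord F N K) j' (gaugeAct uL U₁) c) ≤ v ε δ (K - n) j') ∧
          (∀ j' ≤ K - n, ∀ c : PBond (F.P K) j', c.src ∈ (castSite '' Set.Icc (lo j') (hi j') : Set (Site (F.P K) j')) →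
            c.tgt ∈ (castSite '' Set.Icc (lo j') (hi j') : Set (Site (F.P K) j')) → dist1 (Averaging.iter (avOfRecord F N K) j' U₁ c) ≤ av ε δ (K - n) j') ∧
          (∀ (j' : ℕ) (y : Site (F.P K) j'), ‖lam j' y‖ ≤ ‖mlog (((((toMS uL j' (castSite (lo j')))⁻¹ * toMS uL j' y)⁻¹ : SU N)) : MatA N)‖) ∧
          (∀ c : BondIdx HVd, X c = LatticeFieldCalculus.grad (((F.P K).L : ℝ) ^ (K - n) / ((F.P K).L : ℝ) ^ (c.1.1 : ℕ)) (lam c.1.1) c.1.2) ∧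
          Letters10On (cover (F.P K) '' box (F.P K).L (cornerP (F.P K) Mc ρ idx) (sideP (F.P K) Mc ρ) (K - n)) ((F.P K).eta (K - n)) (t₁ ε δ (K - n)) A₁ ∧
          (∀ b, A b - HV X b = A₁ b + HV B b - HV B' b)),
      Prop8RegSepTopStepG F N (fun ν K Ω => suppDomOfRecord F ν K Ω) Adm B₃ a₀ a₁ := by
  obtain ⟨Mh₀, R₀, CS, BS, CH, δH, BH, hCS, hBS, hCH, hδH, hBH, hmain⟩ := datumGaugeSplitTopStepCoreG_of_prop6P_of_chartMeet F N
  refine ⟨Mh₀, R₀, CS, BS, CH, δH, BH, hCS, hBS, hCH, hδH, hBH, ?_⟩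
  intro B₁ c₁ hB₁ hc₁ ρ hP6 Mc Mh R a' hMc hMcρ hMha hMh hR hdvd hRρ hLρ c c₀ hc hc₀ hmc₀ hac₀ Adm hAdm₁ hAdm₂ B₃ C θ Q a₀ a₁ θH hB₃ hC0 hθ0 hQ0 ha₀ h163
    hB₃L hC hθ ha hκa β₁ β₂ s' σ t₁ v av hletters hbudget hchart
  exact prop8RegSepTopStepG_of_datumGaugeSplitCoreG hMc hLρ
    (hmain hB₁ hc₁ hP6 hMc hMcρ hMha hMh hR hdvd hRρ hLρ hc hc₀ hmc₀ hac₀ Adm hAdm₁ hAdm₂ hB₃ hC0 hθ0 hQ0 ha₀ h163 β₁ β₂ s' σ t₁ v av hletters hbudget hchart)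
    hB₃L hC hθ hQ0 (b9OfP_pos (F := F) Mc ρ hB₁).le ha hκa

end Summit.QuantumFields.YangMills.BalabanUVNodes.N07SplitClauseHeadKnitMeet

end
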